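import Mathlib
import Summits.AtomisticToContinuum.HydrodynamicLimit.Theorems.ImplosionDichotomyDenseExcursionSonicCentreContentInnerSystem
import Summits.AtomisticToContinuum.HydrodynamicLimit.Theorems.ImplosionDichotomyDenseExcursionSonicCentreContentInnerBounds

/-!
# The point package of the centre problem: structured mode system + all size bounds at a point of the inner region
# (crux `DenseExcursion`, line `sonic-cavity-renewal`, brick for `centreContent_of_tube`)

Helper file (`--supports stmt-AtomisticToContinuum-12586`, line lead a2, stub-worker W3 for `centreContent_of_tube`).

Glue between the profile (CavityTube (c), (d) at a point `y` with `eʸ ≤ 1/50`: `inner_tube_atoms`, registered helper), the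
algebra of `…SonicCentreContentInnerSystem` (`inner_UcSc_hasDerivAt`, `inner_vz_hasDerivAt`) and the arithmetic of
`…SonicCentreContentInnerBounds`: `inner_point` delivers, for a solution of the mode equations at `y`, the derivatives of
`𝒰 = eʸŵ`, `𝒮 = eʸŝ`, `v = 𝒮 + (κ/3)𝒰`, `z = κ𝒮` in structured form together with the numerical bounds on the remainders and on
`Re Θ`, `Re κ`, `|κ|`, `A, B, C, D` that the energy inequalities (`…SonicCentreContentInnerIneq`) take as hypotheses.

NOT here: energies, barriers, limits (companion files).
-/

noncomputable section

open Set

namespace Summit.AtomisticToContinuum.HydrodynamicLimit.Theorems.SonicCavityRenewal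

open Summit.AtomisticToContinuum.HydrodynamicLimit.Theorems.R2OneModeTwoConditions

/-- **Registered helper `inner_tube_atoms`: THE TUBE DATA AT A POINT OF THE INNER REGION.** At `y` with `eʸ ≤ 1/50` (so
`y ≤ 0 ≤ 1`), CavityTube (d) (centre expansion with `|W₂|, |s₂| ≤ 1/10`, remainder `2e^{4y}`) and (c) (envelope of `s̃ = eʸS`) give the
four atom bounds consumed by `…SonicCentreContentInnerBounds`: `|W − (r−1)| ≤ ρ²/10 + 2ρ⁴`, `|W′| ≤ ρ²/5 + 2ρ⁴`, `7/10 ≤ ρS ≤ 1`,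
`|(ρS)′| = |ρS + ρS′| ≤ ρ²/5 + 2ρ⁴` (`ρ = eʸ`), and `S > 0`. [folklore] -/
theorem inner_tube_atoms : ∀ {r : ℝ} {W S : ℝ → ℝ}, IsMonatomicProfile r W S → CavityTube r W S → ∀ {y : ℝ}, Real.exp y ≤ 1 / 50 → |W y - (r - 1)| ≤ Real.exp y ^ 2 / 10 + 2 * Real.exp y ^ 4 ∧ |deriv W y| ≤ Real.exp y ^ 2 / 5 + 2 * Real.exp y ^ 4 ∧ 7 / 10 ≤ Real.exp y * S y ∧ Real.exp y * S y ≤ 1 ∧ |Real.exp y * S y + Real.exp y * deriv S y| ≤ Real.exp y ^ 2 / 5 + 2 * Real.exp y ^ 4 ∧ 0 < S y := by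
  intro r W S hP hT y hy
  obtain ⟨-, -, -, hS, hSpos, -⟩ := hP
  obtain ⟨-, -, -, -, -, -, -, -, hcS, ⟨W₂, s₀, s₂, hW₂, -, -, hs₂', hd⟩, -⟩ := hT
  have hy0 : y ≤ 0 := by
    by_contra h
    have : (1 : ℝ) < Real.exp y := Real.one_lt_exp_iff.2 (not_le.mp h)
    linarith
  have hS1 : Differentiable ℝ S := hS.differentiable (by simp)
  obtain ⟨h1, h2, -, -, h5, -⟩ := hd y hy0
  obtain ⟨hs₁, hs₂, -, -⟩ := hcS y (by linarith)
  have e2 : Real.exp (2 * y) = Real.exp y ^ 2 := by rw [show (2:ℝ) * y = y + y by ring, Real.exp_add]; ring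
  have e4 : Real.exp (4 * y) = Real.exp y ^ 4 := by
    rw [show (4:ℝ) * y = 2 * y + 2 * y by ring, Real.exp_add, e2]; ring
  rw [e2, e4] at h1 h2 h5
  have hds : deriv (fun t => Real.exp t * S t) y = Real.exp y * S y + Real.exp y * deriv S y :=
    ((Real.hasDerivAt_exp y).mul (hS1 y).hasDerivAt).deriv
  rw [hds] at h5
  have hρ2 : 0 ≤ Real.exp y ^ 2 := sq_nonneg _
  obtain ⟨hW₂a, hW₂b⟩ := abs_le.mp hW₂
  obtain ⟨hs₂a, hs₂b⟩ := abs_le.mp hs₂'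
  refine ⟨?_, ?_, hs₁, hs₂, ?_, hSpos y⟩
  · obtain ⟨a, b⟩ := abs_le.mp h1
    exact abs_le.mpr ⟨by nlinarith, by nlinarith⟩
  · obtain ⟨a, b⟩ := abs_le.mp h2
    exact abs_le.mpr ⟨by nlinarith, by nlinarith⟩
  · obtain ⟨a, b⟩ := abs_le.mp h5
    exact abs_le.mpr ⟨by nlinarith, by nlinarith⟩

set_option maxHeartbeats 1600000 in
/-- **THE POINT PACKAGE OF THE CENTRE PROBLEM.** For a monatomic profile in the cavity tube on the pinned window, a rate
`−1/4 < Re Λ ≤ 3`, and a solution of the mode equations at a point `y` of the inner region `eʸ ≤ 1/50`: the centre variables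
`𝒰 = eʸŵ`, `𝒮 = eʸŝ` and the travelling-wave pair `v = 𝒮 + (κ/3)𝒰`, `z = κ𝒮` (`κ = Λk`, `k = −S/((W−1)² − S²)`) satisfy the
structured systems of `inner_UcSc_hasDerivAt` / `inner_vz_hasDerivAt` with `Θ = Λθ`, and ALL the size bounds the energy
inequalities consume: `‖E_v‖ ≤ 11ρ²(‖v‖+‖𝒮‖) + (0.42ρ² + 0.74|κ|ρ³)‖𝒮‖ + 0.86ρ‖𝒰‖`, `‖E_z‖ ≤ 6.92ρ²‖z‖ + 0.86ρ|κ|‖𝒰‖`,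
`|Re Θ| ≤ 5.5ρ²`, `|Re κ| ≤ 4.32ρ`, `Re(Θ−κ) ≤ 0.36ρ + 5.5ρ²`, `Re(Θ+κ) ≥ −(0.36ρ + 0.46ρ²)`, `ρ‖Λ‖ ≤ |κ| ≤ 1.44ρ‖Λ‖`,
`|A| ≤ 4.5ρ²`, `|B| ≤ 2.2ρ³`, `|C| ≤ 0.86ρ`, `|D| ≤ 0.42ρ²` (`ρ = eʸ`). [folklore] -/
theorem inner_point {r : ℝ} {W S : ℝ → ℝ} {Λ : ℂ} {ŵ ŝ : ℝ → ℂ} (hr₁ : 17307 / 15625 ≤ r) (hr₂ : r ≤ 89409 / 80000)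
    (hP : IsMonatomicProfile r W S) (hT : CavityTube r W S) (hre₁ : -(1 / 4 : ℝ) < Λ.re) (hre₂ : Λ.re ≤ 3)
    {y : ℝ} (hy : Real.exp y ≤ 1 / 50) (hŵ : DifferentiableAt ℝ ŵ y) (hŝ : DifferentiableAt ℝ ŝ y)
    (hmode : Λ * ŵ y = linW r W S ŵ ŝ y ∧ Λ * ŝ y = linS r W S ŵ ŝ y) :
    ∃ (Θ Ev Ez : ℂ) (A Bc Cc Dc : ℝ),
      HasDerivAt (fun t => (Real.exp t : ℂ) * ŵ t) ((Θ - 2 + A) * ((Real.exp y : ℂ) * ŵ y) + (3 * (Λ * ((-S y / ((W y - 1) ^ 2 - S y ^ 2) : ℝ) : ℂ)) + Bc) * ((Real.exp y : ℂ) * ŝ y)) y ∧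
      HasDerivAt (fun t => (Real.exp t : ℂ) * ŝ t) ((Θ + Dc) * ((Real.exp y : ℂ) * ŝ y) + ((Λ * ((-S y / ((W y - 1) ^ 2 - S y ^ 2) : ℝ) : ℂ)) / 3 + Cc) * ((Real.exp y : ℂ) * ŵ y)) y ∧
      HasDerivAt (fun t => (Real.exp t : ℂ) * ŝ t + (Λ * ((-S t / ((W t - 1) ^ 2 - S t ^ 2) : ℝ) : ℂ) / 3) * ((Real.exp t : ℂ) * ŵ t))
        (Θ * (((Real.exp y : ℂ) * ŝ y) + (Λ * ((-S y / ((W y - 1) ^ 2 - S y ^ 2) : ℝ) : ℂ) / 3) * ((Real.exp y : ℂ) * ŵ y)) + (Λ * ((-S y / ((W y - 1) ^ 2 - S y ^ 2) : ℝ) : ℂ)) * (Λ * ((-S y / ((W y - 1) ^ 2 - S y ^ 2) : ℝ) : ℂ) * ((Real.exp y : ℂ) * ŝ y)) + Ev) y ∧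
      HasDerivAt (fun t => Λ * ((-S t / ((W t - 1) ^ 2 - S t ^ 2) : ℝ) : ℂ) * ((Real.exp t : ℂ) * ŝ t)) (Θ * (Λ * ((-S y / ((W y - 1) ^ 2 - S y ^ 2) : ℝ) : ℂ) * ((Real.exp y : ℂ) * ŝ y)) + (Λ * ((-S y / ((W y - 1) ^ 2 - S y ^ 2) : ℝ) : ℂ)) * (((Real.exp y : ℂ) * ŝ y) + (Λ * ((-S y / ((W y - 1) ^ 2 - S y ^ 2) : ℝ) : ℂ) / 3) * ((Real.exp y : ℂ) * ŵ y)) + Ez) y ∧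
      ‖Ev‖ ≤ 11 * Real.exp y ^ 2 * (‖(((Real.exp y : ℂ) * ŝ y) + (Λ * ((-S y / ((W y - 1) ^ 2 - S y ^ 2) : ℝ) : ℂ) / 3) * ((Real.exp y : ℂ) * ŵ y))‖ + ‖((Real.exp y : ℂ) * ŝ y)‖) +
        (42 / 100 * Real.exp y ^ 2 + 74 / 100 * ‖(Λ * ((-S y / ((W y - 1) ^ 2 - S y ^ 2) : ℝ) : ℂ))‖ * Real.exp y ^ 3) * ‖((Real.exp y : ℂ) * ŝ y)‖ + 86 / 100 * Real.exp y * ‖((Real.exp y : ℂ) * ŵ y)‖ ∧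
      ‖Ez‖ ≤ 692 / 100 * Real.exp y ^ 2 * ‖(Λ * ((-S y / ((W y - 1) ^ 2 - S y ^ 2) : ℝ) : ℂ) * ((Real.exp y : ℂ) * ŝ y))‖ + 86 / 100 * Real.exp y * ‖(Λ * ((-S y / ((W y - 1) ^ 2 - S y ^ 2) : ℝ) : ℂ))‖ * ‖((Real.exp y : ℂ) * ŵ y)‖ ∧
      |Θ.re| ≤ 55 / 10 * Real.exp y ^ 2 ∧ |(Λ * ((-S y / ((W y - 1) ^ 2 - S y ^ 2) : ℝ) : ℂ)).re| ≤ 432 / 100 * Real.exp y ∧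
      (Θ - (Λ * ((-S y / ((W y - 1) ^ 2 - S y ^ 2) : ℝ) : ℂ))).re ≤ 36 / 100 * Real.exp y + 55 / 10 * Real.exp y ^ 2 ∧
      -(36 / 100 * Real.exp y + 46 / 100 * Real.exp y ^ 2) ≤ (Θ + (Λ * ((-S y / ((W y - 1) ^ 2 - S y ^ 2) : ℝ) : ℂ))).re ∧
      Real.exp y * ‖Λ‖ ≤ ‖(Λ * ((-S y / ((W y - 1) ^ 2 - S y ^ 2) : ℝ) : ℂ))‖ ∧ ‖(Λ * ((-S y / ((W y - 1) ^ 2 - S y ^ 2) : ℝ) : ℂ))‖ ≤ 144 / 100 * Real.exp y * ‖Λ‖ ∧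
      |A| ≤ 9 / 2 * Real.exp y ^ 2 ∧ |Bc| ≤ 11 / 5 * Real.exp y ^ 3 ∧ |Cc| ≤ 43 / 50 * Real.exp y ∧
      |Dc| ≤ 21 / 50 * Real.exp y ^ 2 := by
  obtain ⟨hw, hw', hs₁, hs₂, hds, hSpos⟩ := inner_tube_atoms hP hT hy
  obtain ⟨-, -, hWs, hSs, -, -⟩ := hP
  have hρ : 0 < Real.exp y := Real.exp_pos y
  -- the determinant
  have hK := inner_det_lower hr₁ hr₂ hρ hy hw hs₁
  have hD : 0 < S y ^ 2 - (W y - 1) ^ 2 := by nlinarith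
  have hd0 : ((W y - 1) ^ 2 - S y ^ 2) ≠ 0 := by linarith
  -- the coefficients (θ, A, B, C, D as opaque reals with their defining equations; k kept explicit)
  obtain ⟨θr, hθrdef⟩ : ∃ t : ℝ, t = (W y - 1) / ((W y - 1) ^ 2 - S y ^ 2) := ⟨_, rfl⟩
  obtain ⟨A, hAdef⟩ : ∃ t : ℝ, t = 3 + (-(W y - 1) * (deriv W y + 2 * W y - r) + 3 * S y * (deriv S y + 2 * S y)) / ((W y - 1) ^ 2 - S y ^ 2) :=
    ⟨_, rfl⟩
  obtain ⟨Bc, hBdef⟩ : ∃ t : ℝ, t = (-(W y - 1) * (3 * deriv S y + 6 * S y) + 3 * S y * (deriv W y / 3 + 2 * W y - r)) / ((W y - 1) ^ 2 - S y ^ 2) :=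
    ⟨_, rfl⟩
  obtain ⟨Cc, hCdef⟩ : ∃ t : ℝ, t = (-(W y - 1) * (deriv S y + 2 * S y) + S y / 3 * (deriv W y + 2 * W y - r)) / ((W y - 1) ^ 2 - S y ^ 2) :=
    ⟨_, rfl⟩
  obtain ⟨Dc, hDdef⟩ : ∃ t : ℝ, t = 1 + (-(W y - 1) * (deriv W y / 3 + 2 * W y - r) + S y / 3 * (3 * deriv S y + 6 * S y)) / ((W y - 1) ^ 2 - S y ^ 2) :=
    ⟨_, rfl⟩
  have hθ : θr * ((W y - 1) ^ 2 - S y ^ 2) = W y - 1 := by rw [hθrdef]; field_simp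
  have hk : (-S y / ((W y - 1) ^ 2 - S y ^ 2)) * ((W y - 1) ^ 2 - S y ^ 2) = -S y := by field_simp
  have hA : (A - 3) * ((W y - 1) ^ 2 - S y ^ 2) = -(W y - 1) * (deriv W y + 2 * W y - r) + 3 * S y * (deriv S y + 2 * S y) := by
    rw [hAdef]; field_simp; ring
  have hB : Bc * ((W y - 1) ^ 2 - S y ^ 2) = -(W y - 1) * (3 * deriv S y + 6 * S y) + 3 * S y * (deriv W y / 3 + 2 * W y - r) := by
    rw [hBdef]; field_simp
  have hC : Cc * ((W y - 1) ^ 2 - S y ^ 2) = -(W y - 1) * (deriv S y + 2 * S y) + S y / 3 * (deriv W y + 2 * W y - r) := by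
    rw [hCdef]; field_simp
  have hDq : (Dc - 1) * ((W y - 1) ^ 2 - S y ^ 2) = -(W y - 1) * (deriv W y / 3 + 2 * W y - r) + S y / 3 * (3 * deriv S y + 6 * S y) := by
    rw [hDdef]; field_simp; ring
  -- the centre system
  obtain ⟨hU, hS⟩ := inner_UcSc_hasDerivAt hŵ hŝ hmode.1 hmode.2 hd0 hθ hk hA hB hC hDq
  -- the acoustic coefficient as a function and its derivative
  have hW1 : Differentiable ℝ W := hWs.differentiable (by simp)
  have hS1 : Differentiable ℝ S := hSs.differentiable (by simp)
  have hdd : HasDerivAt (fun t => (W t - 1) ^ 2 - S t ^ 2) (2 * (W y - 1) * deriv W y - 2 * S y * deriv S y) y := by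
    have h := (((hW1 y).hasDerivAt.sub_const 1).fun_pow 2).fun_sub ((hS1 y).hasDerivAt.fun_pow 2)
    refine h.congr_deriv ?_
    norm_num
  obtain ⟨kr', hkr'def⟩ : ∃ t : ℝ, t = (-deriv S y * ((W y - 1) ^ 2 - S y ^ 2) - -S y * (2 * (W y - 1) * deriv W y - 2 * S y * deriv S y)) / ((W y - 1) ^ 2 - S y ^ 2) ^ 2 :=
    ⟨_, rfl⟩
  have hkf : HasDerivAt (fun t => -S t / ((W t - 1) ^ 2 - S t ^ 2)) kr' y := by
    rw [hkr'def]; exact ((hS1 y).hasDerivAt.neg).div hdd hd0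
  have hkr0 : (-S y / ((W y - 1) ^ 2 - S y ^ 2)) ≠ 0 := div_ne_zero (by linarith) hd0
  have hk' : kr' * ((W y - 1) ^ 2 - S y ^ 2) ^ 2 = -deriv S y * ((W y - 1) ^ 2 - S y ^ 2) + S y * (2 * (W y - 1) * deriv W y - 2 * S y * deriv S y) := by
    rw [hkr'def]; field_simp; ring
  -- the pair system (hypotheses restated in the un-reduced form of `inner_vz_hasDerivAt`)
  have hU' : HasDerivAt (fun t => (Real.exp t : ℂ) * ŵ t)
      ((Λ * θr - 2 + A) * ((fun t => (Real.exp t : ℂ) * ŵ t) y) + (3 * (Λ * (((fun t => -S t / ((W t - 1) ^ 2 - S t ^ 2)) y : ℝ) : ℂ)) + Bc) * ((fun t => (Real.exp t : ℂ) * ŝ t) y)) y := hU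
  have hS' : HasDerivAt (fun t => (Real.exp t : ℂ) * ŝ t)
      ((Λ * θr + Dc) * ((fun t => (Real.exp t : ℂ) * ŝ t) y) + (Λ * (((fun t => -S t / ((W t - 1) ^ 2 - S t ^ 2)) y : ℝ) : ℂ) / 3 + Cc) * ((fun t => (Real.exp t : ℂ) * ŵ t) y)) y := hS
  have hkr0' : (fun t => -S t / ((W t - 1) ^ 2 - S t ^ 2)) y ≠ 0 := hkr0
  obtain ⟨hv, hz⟩ := @inner_vz_hasDerivAt (fun t => (Real.exp t : ℂ) * ŵ t) (fun t => (Real.exp t : ℂ) * ŝ t)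
    (fun t => -S t / ((W t - 1) ^ 2 - S t ^ 2)) Λ (Λ * θr) A Bc Cc Dc kr' y hU' hS' hkf hkr0'
  -- the bounds
  obtain ⟨hθb, hθ0⟩ := inner_theta_bound hr₁ hr₂ hρ hy hw hs₁ hθ
  obtain ⟨hk₁, hk₂⟩ := inner_k_bounds hr₁ hr₂ hρ hy hw hs₁ hs₂ hk
  have hAb := inner_A_bound hr₁ hr₂ hρ hy hw hw' hs₁ hs₂ hds hA
  have hBb := inner_B_bound hr₁ hr₂ hρ hy hw hw' hs₁ hs₂ hds hB
  have hCb := inner_C_bound hr₁ hr₂ hρ hy hw hw' hs₁ hs₂ hds hk hC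
  have hDb := inner_D_bound hr₁ hr₂ hρ hy hw hw' hs₁ hs₂ hds hDq
  have hgb := inner_gk_bound hr₁ hr₂ hρ hy hw hw' hs₁ hs₂ hds hk hk'
  -- real parts and sizes of Θ = Λθ and κ = Λk
  have hΛre : |Λ.re| ≤ 3 := abs_le.mpr ⟨by linarith, hre₂⟩
  have hΘre : (Λ * (θr : ℂ)).re = Λ.re * θr := by simp [Complex.mul_re]
  have hκre : (Λ * (((-S y / ((W y - 1) ^ 2 - S y ^ 2)) : ℝ) : ℂ)).re = Λ.re * (-S y / ((W y - 1) ^ 2 - S y ^ 2)) := by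
    rw [Complex.mul_re, Complex.ofReal_re, Complex.ofReal_im, mul_zero, sub_zero]
  have hkr0p : 0 < (-S y / ((W y - 1) ^ 2 - S y ^ 2)) := lt_of_lt_of_le hρ hk₁
  have hκn : ‖Λ * (((-S y / ((W y - 1) ^ 2 - S y ^ 2)) : ℝ) : ℂ)‖ = ‖Λ‖ * (-S y / ((W y - 1) ^ 2 - S y ^ 2)) := by
    rw [norm_mul, Complex.norm_real, Real.norm_of_nonneg hkr0p.le]
  obtain ⟨hθb₁, hθb₂⟩ := abs_le.mp hθb
  refine ⟨Λ * θr, _, _, A, Bc, Cc, Dc, hU, hS, hv, hz, ?_, ?_, ?_, ?_, ?_, ?_, ?_, ?_, hAb, hBb, hCb, hDb⟩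
  · -- ‖E_v‖
    have hg : |kr' / (-S y / ((W y - 1) ^ 2 - S y ^ 2)) - 1 + A| ≤ 11 * Real.exp y ^ 2 := by
      have := abs_add_le (kr' / (-S y / ((W y - 1) ^ 2 - S y ^ 2)) - 1) A
      linarith
    have hco : ‖((Dc : ℝ) : ℂ) + Λ * (((-S y / ((W y - 1) ^ 2 - S y ^ 2)) : ℝ) : ℂ) * (Bc : ℂ) / 3‖ ≤ 42 / 100 * Real.exp y ^ 2 + 74 / 100 * ‖Λ * (((-S y / ((W y - 1) ^ 2 - S y ^ 2)) : ℝ) : ℂ)‖ * Real.exp y ^ 3 := by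
      refine (norm_add_le _ _).trans (add_le_add ?_ ?_)
      · rw [Complex.norm_real, Real.norm_eq_abs]; exact hDb.trans (by norm_num)
      · rw [norm_div, norm_mul, Complex.norm_real, Real.norm_eq_abs, Complex.norm_ofNat]
        have h0 : 0 ≤ ‖Λ * (((-S y / ((W y - 1) ^ 2 - S y ^ 2)) : ℝ) : ℂ)‖ := norm_nonneg _
        have h1 : ‖Λ * (((-S y / ((W y - 1) ^ 2 - S y ^ 2)) : ℝ) : ℂ)‖ * |Bc| ≤ ‖Λ * (((-S y / ((W y - 1) ^ 2 - S y ^ 2)) : ℝ) : ℂ)‖ * (11 / 5 * Real.exp y ^ 3) := mul_le_mul_of_nonneg_left hBb h0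
        have h2 : 0 ≤ ‖Λ * (((-S y / ((W y - 1) ^ 2 - S y ^ 2)) : ℝ) : ℂ)‖ * Real.exp y ^ 3 := by positivity
        linarith
    have t1 : ‖(((kr' / (-S y / ((W y - 1) ^ 2 - S y ^ 2)) - 1 + A : ℝ)) : ℂ) * (((Real.exp y : ℂ) * ŝ y) + Λ * (((-S y / ((W y - 1) ^ 2 - S y ^ 2)) : ℝ) : ℂ) / 3 * ((Real.exp y : ℂ) * ŵ y) - ((Real.exp y : ℂ) * ŝ y))‖ ≤
        11 * Real.exp y ^ 2 * (‖((Real.exp y : ℂ) * ŝ y) + Λ * (((-S y / ((W y - 1) ^ 2 - S y ^ 2)) : ℝ) : ℂ) / 3 * ((Real.exp y : ℂ) * ŵ y)‖ + ‖((Real.exp y : ℂ) * ŝ y)‖) := by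
      rw [norm_mul, Complex.norm_real, Real.norm_eq_abs]
      exact mul_le_mul hg (norm_sub_le _ _) (norm_nonneg _) (by positivity)
    have t2 : ‖(((Dc : ℝ) : ℂ) + Λ * (((-S y / ((W y - 1) ^ 2 - S y ^ 2)) : ℝ) : ℂ) * (Bc : ℂ) / 3) * ((Real.exp y : ℂ) * ŝ y)‖ ≤
        (42 / 100 * Real.exp y ^ 2 + 74 / 100 * ‖Λ * (((-S y / ((W y - 1) ^ 2 - S y ^ 2)) : ℝ) : ℂ)‖ * Real.exp y ^ 3) * ‖((Real.exp y : ℂ) * ŝ y)‖ := by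
      rw [norm_mul]
      exact mul_le_mul_of_nonneg_right hco (norm_nonneg _)
    have t3 : ‖((Cc : ℝ) : ℂ) * ((Real.exp y : ℂ) * ŵ y)‖ ≤ 43 / 50 * Real.exp y * ‖((Real.exp y : ℂ) * ŵ y)‖ := by
      rw [norm_mul, Complex.norm_real, Real.norm_eq_abs]
      exact mul_le_mul_of_nonneg_right hCb (norm_nonneg _)
    have t0 := norm_add₃_le (a := (((kr' / (-S y / ((W y - 1) ^ 2 - S y ^ 2)) - 1 + A : ℝ)) : ℂ) * (((Real.exp y : ℂ) * ŝ y) + Λ * (((-S y / ((W y - 1) ^ 2 - S y ^ 2)) : ℝ) : ℂ) / 3 * ((Real.exp y : ℂ) * ŵ y) - ((Real.exp y : ℂ) * ŝ y)))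
      (b := (((Dc : ℝ) : ℂ) + Λ * (((-S y / ((W y - 1) ^ 2 - S y ^ 2)) : ℝ) : ℂ) * (Bc : ℂ) / 3) * ((Real.exp y : ℂ) * ŝ y)) (c := ((Cc : ℝ) : ℂ) * ((Real.exp y : ℂ) * ŵ y))
    linarith [t0, t1, t2, t3]
  · -- ‖E_z‖
    have hg : |kr' / (-S y / ((W y - 1) ^ 2 - S y ^ 2)) - 1 + Dc| ≤ 692 / 100 * Real.exp y ^ 2 := by
      have := abs_add_le (kr' / (-S y / ((W y - 1) ^ 2 - S y ^ 2)) - 1) Dc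
      linarith
    have t1 : ‖(((kr' / (-S y / ((W y - 1) ^ 2 - S y ^ 2)) - 1 + Dc : ℝ)) : ℂ) * (Λ * (((-S y / ((W y - 1) ^ 2 - S y ^ 2)) : ℝ) : ℂ) * ((Real.exp y : ℂ) * ŝ y))‖ ≤ 692 / 100 * Real.exp y ^ 2 * ‖Λ * (((-S y / ((W y - 1) ^ 2 - S y ^ 2)) : ℝ) : ℂ) * ((Real.exp y : ℂ) * ŝ y)‖ := by
      rw [norm_mul, Complex.norm_real, Real.norm_eq_abs]
      exact mul_le_mul_of_nonneg_right hg (norm_nonneg _)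
    have t2 : ‖Λ * (((-S y / ((W y - 1) ^ 2 - S y ^ 2)) : ℝ) : ℂ) * (Cc : ℂ) * ((Real.exp y : ℂ) * ŵ y)‖ ≤ 86 / 100 * Real.exp y * ‖Λ * (((-S y / ((W y - 1) ^ 2 - S y ^ 2)) : ℝ) : ℂ)‖ * ‖((Real.exp y : ℂ) * ŵ y)‖ := by
      rw [norm_mul, norm_mul, Complex.norm_real, Real.norm_eq_abs]
      have h1 : ‖Λ * (((-S y / ((W y - 1) ^ 2 - S y ^ 2)) : ℝ) : ℂ)‖ * |Cc| ≤ ‖Λ * (((-S y / ((W y - 1) ^ 2 - S y ^ 2)) : ℝ) : ℂ)‖ * (43 / 50 * Real.exp y) := mul_le_mul_of_nonneg_left hCb (norm_nonneg _)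
      have h2 := mul_le_mul_of_nonneg_right h1 (norm_nonneg ((Real.exp y : ℂ) * ŵ y))
      have e1 : ‖Λ * (((-S y / ((W y - 1) ^ 2 - S y ^ 2)) : ℝ) : ℂ)‖ * (43 / 50 * Real.exp y) * ‖((Real.exp y : ℂ) * ŵ y)‖ = 86 / 100 * Real.exp y * ‖Λ * (((-S y / ((W y - 1) ^ 2 - S y ^ 2)) : ℝ) : ℂ)‖ * ‖((Real.exp y : ℂ) * ŵ y)‖ := by ring
      linarith [h2, e1]
    have t0 := norm_add_le ((((kr' / (-S y / ((W y - 1) ^ 2 - S y ^ 2)) - 1 + Dc : ℝ)) : ℂ) * (Λ * (((-S y / ((W y - 1) ^ 2 - S y ^ 2)) : ℝ) : ℂ) * ((Real.exp y : ℂ) * ŝ y))) (Λ * (((-S y / ((W y - 1) ^ 2 - S y ^ 2)) : ℝ) : ℂ) * (Cc : ℂ) * ((Real.exp y : ℂ) * ŵ y))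
    linarith [t0, t1, t2]
  · -- |Re Θ|
    rw [hΘre, abs_mul, abs_of_nonneg hθ0]
    have hsq : 0 ≤ Real.exp y ^ 2 := sq_nonneg _
    calc |Λ.re| * θr ≤ 3 * (183 / 100 * Real.exp y ^ 2) := mul_le_mul hΛre hθb₂ hθ0 (by norm_num)
      _ ≤ 55 / 10 * Real.exp y ^ 2 := by linarith
  · -- |Re κ|
    rw [hκre, abs_mul, abs_of_pos hkr0p]
    calc |Λ.re| * (-S y / ((W y - 1) ^ 2 - S y ^ 2)) ≤ 3 * (144 / 100 * Real.exp y) := mul_le_mul hΛre hk₂ hkr0p.le (by norm_num)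
      _ = 432 / 100 * Real.exp y := by ring
  · -- Re (Θ − κ)
    rw [Complex.sub_re, hΘre, hκre]
    rcases le_or_gt 0 Λ.re with hpos | hneg
    · have h1 : Λ.re * θr ≤ 3 * (183 / 100 * Real.exp y ^ 2) := mul_le_mul hre₂ hθb₂ hθ0 (by norm_num)
      have h2 : 0 ≤ Λ.re * (-S y / ((W y - 1) ^ 2 - S y ^ 2)) := mul_nonneg hpos hkr0p.le
      have hsq : 0 ≤ Real.exp y ^ 2 := sq_nonneg _
      linarith
    · have h1 : -Λ.re * (-S y / ((W y - 1) ^ 2 - S y ^ 2)) ≤ 1 / 4 * (144 / 100 * Real.exp y) := mul_le_mul (by linarith) hk₂ hkr0p.le (by norm_num)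
      have h2 : Λ.re * θr ≤ 0 := mul_nonpos_of_nonpos_of_nonneg hneg.le hθ0
      have hsq : 0 ≤ Real.exp y ^ 2 := sq_nonneg _
      linarith
  · -- Re (Θ + κ)
    rw [Complex.add_re, hΘre, hκre]
    rcases le_or_gt 0 Λ.re with hpos | hneg
    · have h1 : 0 ≤ Λ.re * θr := mul_nonneg hpos hθ0
      have h2 : 0 ≤ Λ.re * (-S y / ((W y - 1) ^ 2 - S y ^ 2)) := mul_nonneg hpos hkr0p.le
      have hsq : 0 ≤ Real.exp y ^ 2 := sq_nonneg _
      linarith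
    · have h1 : -Λ.re * (-S y / ((W y - 1) ^ 2 - S y ^ 2)) ≤ 1 / 4 * (144 / 100 * Real.exp y) := mul_le_mul (by linarith) hk₂ hkr0p.le (by norm_num)
      have h2 : -Λ.re * θr ≤ 1 / 4 * (183 / 100 * Real.exp y ^ 2) := mul_le_mul (by linarith) hθb₂ hθ0 (by norm_num)
      have hsq : 0 ≤ Real.exp y ^ 2 := sq_nonneg _
      linarith
  · -- ‖κ‖ from below
    rw [hκn, mul_comm]
    exact mul_le_mul_of_nonneg_left hk₁ (norm_nonneg _)
  · -- ‖κ‖ from above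
    rw [hκn]
    calc ‖Λ‖ * (-S y / ((W y - 1) ^ 2 - S y ^ 2)) ≤ ‖Λ‖ * (144 / 100 * Real.exp y) := mul_le_mul_of_nonneg_left hk₂ (norm_nonneg _)
      _ = 144 / 100 * Real.exp y * ‖Λ‖ := by ring

end Summit.AtomisticToContinuum.HydrodynamicLimit.Theorems.SonicCavityRenewal

end
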